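import Summits.CriticalPhenomena.Ising3DConformalLimit.Theorems.PerfectScreeningCoulombImpliesNontrivialBlockLaw
import Summits.CriticalPhenomena.Ising3DConformalLimit.Theorems.PerfectScreeningCoulombImpliesNontrivialLeeYangPackage
import Summits.CriticalPhenomena.Ising3DConformalLimit.Theorems.PerfectScreeningCoulombImpliesNontrivialBlockFieldDomination
import Summits.CriticalPhenomena.Ising3DConformalLimit.Theorems.PerfectScreeningCoulombImpliesNontrivialBlockVariance
import Literature.Barriers.CriticalPhenomena.LongRangeTrivialityOnZ3LeeYang
import Literature.Probability.LatticeModels.MagnetizationExponentUpper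

/-!
# The lower critical isotherm under the Coulomb bound (line `SketchPub`: the residual S6 is sharp)

Crux `CoulombImpliesNontrivial` of route `PerfectScreening` (Ising3DConformalLimit), item
stmt-CriticalPhenomena-13885. The residual of line `SketchPub` is the UPPER critical isotherm under the
Coulomb antecedent, `m(β_c,h) ≤ A h^{1/5}`. This file proves the converse inequality from the same
antecedent,

  `Coulomb ⟹ c · h^{1/5} ≤ m(β_c, h)`  (`0 < h ≤ h₀`),

i.e. "δ ≥ 5 with amplitude at η = 0" — the Buckingham–Gunton/Fisher direction of magnetic hyperscaling,
here obtained from the Lee–Yang structure of the critical block spin: so the residual S6 asks exactly for the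
matching upper bound (it is Fisher-sharp), and under the contradiction hypothesis of the line nothing weaker
than S6 can close it.

Proof. Let `M_L = Σ_{x∈box L} σ_x`, `Σ_L = ⟨M_L²⟩_{β_c}`, and let `(m, b₁…b_n)` be the Lee–Yang package of the
critical block law (landed stubs S1a `stub_blockLaw` + S1b `stub_leeYangPackage`):
`⟨e^{tM_L}⟩ = cosh^m t ∏(1 + bᵢ sinh² t)`, `⟨M_L e^{tM_L}⟩ = ⟨e^{tM_L}⟩·(m tanh t + Σ 2bᵢ sinh t cosh t/(1 + bᵢ sinh² t))`,
`m + 2Σbᵢ = Σ_L`, `bᵢ ≥ 1`.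
* `blockMgf_le_exp` — **Gaussian domination** `⟨e^{tM_L}⟩ ≤ exp(t² Σ_L/2)` (`cosh t ≤ e^{t²/2}`,
  `1 + b sinh² t ≤ e^{bt²}` for `b ≥ 1`, tree `NewmanLeeYang.one_add_mul_sinh_sq_le_exp`).
* `mul_blockVar_le_blockTilt` — **linear response from below** `t Σ_L ≤ ⟨M_L e^{tM_L}⟩` for `t ≥ 0`
  (each factor of the product is `≥ 1`, `sinh t ≥ t`, `cosh t ≥ 1`).
* S3 `stub_blockFieldDomination` (GKS): `⟨M_L e^{β_c h M_L}⟩ ≤ (2L+1)³ m(β_c,h) ⟨e^{β_c h M_L}⟩`, and S4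
  `stub_blockVariance`: `c L⁵ ≤ Σ_L ≤ C L⁵` under Coulomb. With `t = β_c h` and `L ≍ (C t²)^{-1/5}`
  (so that `t²Σ_L ≤ 1`): `m(β_c,h) ≥ t c L⁵/(27 L³ e^{1/2}) ≍ t^{1/5}`.
-/

noncomputable section

namespace Summit.CriticalPhenomena.Ising3DConformalLimit.PerfectScreeningCoulombImpliesNontrivial

open Literature.Probability.LatticeModels Filter Set Finset
open scoped Topology BigOperators

/-- The Lee–Yang package of the critical block `M_L = Σ_{x ∈ box 3 L} σ_x` (from the landed S1a + S1b):
`bᵢ ≥ 1`, the product formula for `⟨e^{tM_L}⟩`, the tilted-mean formula for `⟨M_L e^{tM_L}⟩`, and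
`m + 2Σbᵢ = ⟨M_L²⟩`. -/
theorem blockPackage_exp (L : ℕ) :
    ∃ (m n : ℕ) (b : Fin n → ℝ), (∀ i, 1 ≤ b i) ∧
      (∀ t : ℝ, plusExpect 3 (criticalBeta 3) 0 (fun σ => Real.exp (t * ∑ x ∈ box 3 L, spinAt x σ)) =
        Real.cosh t ^ m * ∏ i, (1 + b i * Real.sinh t ^ 2)) ∧
      (∀ t : ℝ, plusExpect 3 (criticalBeta 3) 0
          (fun σ => (∑ x ∈ box 3 L, spinAt x σ) * Real.exp (t * ∑ x ∈ box 3 L, spinAt x σ)) =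
        (Real.cosh t ^ m * ∏ i, (1 + b i * Real.sinh t ^ 2)) *
          (m * Real.tanh t + ∑ i, 2 * b i * Real.sinh t * Real.cosh t / (1 + b i * Real.sinh t ^ 2))) ∧
      ((m : ℝ) + 2 * ∑ i, b i = plusExpect 3 (criticalBeta 3) 0 (fun σ => (∑ x ∈ box 3 L, spinAt x σ) ^ 2)) := by
  obtain ⟨p, hp0, hsymm, hpar, hmass, hlaw, hLY⟩ := stub_blockLaw L
  obtain ⟨m, n, b, hb, -, -, hexp, htilt, hvar, -, -⟩ :=
    stub_leeYangPackage ((2 * L + 1) ^ 3) p hp0 hsymm hpar hmass hLY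
  refine ⟨m, n, b, hb, fun t => ?_, fun t => ?_, ?_⟩
  · rw [hlaw (fun u => Real.exp (t * u)), hexp]
  · rw [hlaw (fun u => u * Real.exp (t * u)), htilt]
  · rw [hvar, hlaw (fun u => u ^ 2)]

/-- **Gaussian domination of the critical block mgf** (Newman; Lee–Yang product formula):
`⟨e^{tM_L}⟩_{β_c} ≤ exp(t² ⟨M_L²⟩/2)` for every real `t`. -/
theorem blockMgf_le_exp (L : ℕ) (t : ℝ) :
    plusExpect 3 (criticalBeta 3) 0 (fun σ => Real.exp (t * ∑ x ∈ box 3 L, spinAt x σ)) ≤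
      Real.exp (t ^ 2 * plusExpect 3 (criticalBeta 3) 0 (fun σ => (∑ x ∈ box 3 L, spinAt x σ) ^ 2) / 2) := by
  obtain ⟨m, n, b, hb, hexp, -, hvar⟩ := blockPackage_exp L
  rw [hexp t, ← hvar]
  have h1 : Real.cosh t ^ m ≤ Real.exp (m * t ^ 2 / 2) := by
    calc Real.cosh t ^ m ≤ Real.exp (t ^ 2 / 2) ^ m :=
          pow_le_pow_left₀ (Real.cosh_pos t).le (Real.cosh_le_exp_half_sq t) m
      _ = Real.exp (m * t ^ 2 / 2) := by rw [← Real.exp_nat_mul]; congr 1; ring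
  have h2 : ∏ i, (1 + b i * Real.sinh t ^ 2) ≤ Real.exp (t ^ 2 * ∑ i, b i) := by
    calc ∏ i, (1 + b i * Real.sinh t ^ 2) ≤ ∏ i, Real.exp (b i * t ^ 2) :=
          Finset.prod_le_prod (fun i _ => by have := hb i; positivity)
            (fun i _ => Literature.Barriers.CriticalPhenomena.NewmanLeeYang.one_add_mul_sinh_sq_le_exp (hb i) t)
      _ = Real.exp (∑ i, b i * t ^ 2) := (Real.exp_sum _ _).symm
      _ = Real.exp (t ^ 2 * ∑ i, b i) := by rw [Finset.mul_sum]; congr 1; exact Finset.sum_congr rfl fun i _ => by ring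
  have h0 : 0 ≤ ∏ i, (1 + b i * Real.sinh t ^ 2) :=
    Finset.prod_nonneg fun i _ => by have := hb i; positivity
  calc Real.cosh t ^ m * ∏ i, (1 + b i * Real.sinh t ^ 2)
      ≤ Real.exp (m * t ^ 2 / 2) * Real.exp (t ^ 2 * ∑ i, b i) :=
        mul_le_mul h1 h2 h0 (Real.exp_pos _).le
    _ = Real.exp (t ^ 2 * ((m : ℝ) + 2 * ∑ i, b i) / 2) := by rw [← Real.exp_add]; congr 1; ring

/-- **Linear response from below**: `t ⟨M_L²⟩ ≤ ⟨M_L e^{tM_L}⟩_{β_c}` for `t ≥ 0` (tilted-mean formula;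
every factor of `cosh^m t ∏(1 + bⱼ sinh² t)` is `≥ 1`, `sinh t ≥ t`, `cosh t ≥ 1`). -/
theorem mul_blockVar_le_blockTilt (L : ℕ) {t : ℝ} (ht : 0 ≤ t) :
    t * plusExpect 3 (criticalBeta 3) 0 (fun σ => (∑ x ∈ box 3 L, spinAt x σ) ^ 2) ≤
      plusExpect 3 (criticalBeta 3) 0
        (fun σ => (∑ x ∈ box 3 L, spinAt x σ) * Real.exp (t * ∑ x ∈ box 3 L, spinAt x σ)) := by
  obtain ⟨m, n, b, hb, -, htilt, hvar⟩ := blockPackage_exp L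
  rw [htilt t, ← hvar]
  set s : ℝ := Real.sinh t with hs
  set c : ℝ := Real.cosh t with hc
  set P : ℝ := c ^ m * ∏ i, (1 + b i * s ^ 2) with hP
  have hs0 : 0 ≤ s := Real.sinh_nonneg_iff.2 ht
  have hts : t ≤ s := Real.self_le_sinh_iff.2 ht
  have hc1 : 1 ≤ c := Real.one_le_cosh t
  have hfac1 : ∀ i, 1 ≤ 1 + b i * s ^ 2 := fun i => by have := hb i; nlinarith [sq_nonneg s]
  have hprod1 : 1 ≤ ∏ i, (1 + b i * s ^ 2) := by
    calc (1 : ℝ) = ∏ _i : Fin n, (1 : ℝ) := Finset.prod_const_one.symm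
      _ ≤ ∏ i, (1 + b i * s ^ 2) := Finset.prod_le_prod (fun _ _ => zero_le_one) (fun i _ => hfac1 i)
  have hcm1 : 1 ≤ c ^ m := one_le_pow₀ hc1
  have hP1 : 1 ≤ P := by rw [hP]; nlinarith
  have hP0 : 0 ≤ P := zero_le_one.trans hP1
  -- the `m`-term: `P · m tanh t ≥ m t`
  have hm_term : (m : ℝ) * t ≤ P * (m * Real.tanh t) := by
    rcases Nat.eq_zero_or_pos m with hm0 | hmpos
    · simp [hm0]
    · have hcpow : c ≤ c ^ m := le_self_pow₀ hc1 hmpos.ne'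
      have hPc : c ≤ P := by
        rw [hP]
        calc c = c * 1 := (mul_one c).symm
          _ ≤ c ^ m * ∏ i, (1 + b i * s ^ 2) :=
              mul_le_mul hcpow hprod1 zero_le_one (zero_le_one.trans hcm1)
      have htanh : Real.tanh t = s / c := by rw [hs, hc, Real.tanh_eq_sinh_div_cosh]
      have hcpos : 0 < c := Real.cosh_pos t
      have htanh0 : 0 ≤ Real.tanh t := by rw [htanh]; positivity
      calc (m : ℝ) * t ≤ m * s := mul_le_mul_of_nonneg_left hts (Nat.cast_nonneg m)
        _ = c * (m * Real.tanh t) := by rw [htanh]; field_simp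
        _ ≤ P * (m * Real.tanh t) := mul_le_mul_of_nonneg_right hPc (by positivity)
  -- the `i`-terms: `P · 2bᵢ s c/(1 + bᵢ s²) ≥ 2bᵢ t`
  have hi_term : ∀ i, 2 * b i * t ≤ P * (2 * b i * s * c / (1 + b i * s ^ 2)) := by
    intro i
    have hbi : 0 ≤ b i := zero_le_one.trans (hb i)
    have hfi : 0 < 1 + b i * s ^ 2 := zero_lt_one.trans_le (hfac1 i)
    -- `1 + bᵢ s² ≤ P`
    have hPi : 1 + b i * s ^ 2 ≤ P := by
      rw [hP]
      have hsplit : ∏ j, (1 + b j * s ^ 2) = (1 + b i * s ^ 2) * ∏ j ∈ Finset.univ.erase i, (1 + b j * s ^ 2) :=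
        (Finset.mul_prod_erase Finset.univ (fun j => 1 + b j * s ^ 2) (Finset.mem_univ i)).symm
      have hrest : 1 ≤ ∏ j ∈ Finset.univ.erase i, (1 + b j * s ^ 2) := by
        calc (1 : ℝ) = ∏ _j ∈ Finset.univ.erase i, (1 : ℝ) := Finset.prod_const_one.symm
          _ ≤ ∏ j ∈ Finset.univ.erase i, (1 + b j * s ^ 2) :=
              Finset.prod_le_prod (fun _ _ => zero_le_one) (fun j _ => hfac1 j)
      calc 1 + b i * s ^ 2 = 1 * ((1 + b i * s ^ 2) * 1) := by ring
        _ ≤ c ^ m * ((1 + b i * s ^ 2) * ∏ j ∈ Finset.univ.erase i, (1 + b j * s ^ 2)) :=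
            mul_le_mul hcm1 (mul_le_mul_of_nonneg_left hrest hfi.le) (by positivity) (by positivity)
        _ = c ^ m * ∏ j, (1 + b j * s ^ 2) := by rw [hsplit]
    calc 2 * b i * t ≤ 2 * b i * s * c := by nlinarith [mul_nonneg hbi hs0]
      _ = (1 + b i * s ^ 2) * (2 * b i * s * c / (1 + b i * s ^ 2)) := by field_simp
      _ ≤ P * (2 * b i * s * c / (1 + b i * s ^ 2)) :=
          mul_le_mul_of_nonneg_right hPi (by positivity)
  have hsum1 : ∑ i, 2 * b i * t = t * (2 * ∑ i, b i) := by
    rw [Finset.mul_sum, Finset.mul_sum]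
    exact Finset.sum_congr rfl fun i _ => by ring
  have hsum2 : ∑ i, P * (2 * b i * s * c / (1 + b i * s ^ 2)) =
      P * ∑ i, 2 * b i * s * c / (1 + b i * s ^ 2) := by rw [Finset.mul_sum]
  calc t * ((m : ℝ) + 2 * ∑ i, b i) = (m : ℝ) * t + ∑ i, 2 * b i * t := by rw [hsum1]; ring
    _ ≤ P * (m * Real.tanh t) + ∑ i, P * (2 * b i * s * c / (1 + b i * s ^ 2)) :=
        add_le_add hm_term (Finset.sum_le_sum fun i _ => hi_term i)
    _ = P * (m * Real.tanh t + ∑ i, 2 * b i * s * c / (1 + b i * s ^ 2)) := by rw [hsum2]; ring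

/-- The arithmetic of the final step: from `t c₄ L⁵ ≤ tV ≤ T ≤ (2L+1)³·mag·E`, `E ≤ 2`, `L ≥ 1`,
`x ≤ 2L` conclude `(c₄/216)·t·x² ≤ mag`. -/
theorem mag_lower_of_chain {t c₄ Lr x V T E mag : ℝ} (ht : 0 < t) (hc₄ : 0 < c₄) (hL1 : 1 ≤ Lr)
    (hxL : x ≤ 2 * Lr) (hx0 : 0 ≤ x) (hVlo : c₄ * Lr ^ 5 ≤ V) (htilt : t * V ≤ T)
    (hS3 : T ≤ (2 * Lr + 1) ^ 3 * mag * E) (hE : E ≤ 2) (hmag : 0 ≤ mag) :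
    c₄ / 216 * (t * x ^ 2) ≤ mag := by
  have hL0 : 0 < Lr := one_pos.trans_le hL1
  have hcube : (2 * Lr + 1) ^ 3 ≤ 27 * Lr ^ 3 := by
    have h3 : 2 * Lr + 1 ≤ 3 * Lr := by linarith
    calc (2 * Lr + 1) ^ 3 ≤ (3 * Lr) ^ 3 := pow_le_pow_left₀ (by linarith) h3 3
      _ = 27 * Lr ^ 3 := by ring
  have h1 : T ≤ 27 * Lr ^ 3 * mag * 2 := by
    calc T ≤ (2 * Lr + 1) ^ 3 * mag * E := hS3
      _ ≤ (2 * Lr + 1) ^ 3 * mag * 2 := mul_le_mul_of_nonneg_left hE (by positivity)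
      _ ≤ 27 * Lr ^ 3 * mag * 2 := by
          have := mul_le_mul_of_nonneg_right hcube (mul_nonneg hmag zero_le_two)
          nlinarith
  have h2 : t * (c₄ * Lr ^ 5) ≤ 54 * Lr ^ 3 * mag := by
    have := mul_le_mul_of_nonneg_left hVlo ht.le
    linarith
  have h3 : t * c₄ * Lr ^ 2 ≤ 54 * mag := by
    have hL3 : 0 < Lr ^ 3 := pow_pos hL0 3
    have key : Lr ^ 3 * (t * c₄ * Lr ^ 2) ≤ Lr ^ 3 * (54 * mag) := by nlinarith
    exact le_of_mul_le_mul_left key hL3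
  have h4 : x ^ 2 ≤ 4 * Lr ^ 2 := by nlinarith
  have h5 : t * c₄ * x ^ 2 ≤ 4 * (t * c₄ * Lr ^ 2) := by
    have := mul_le_mul_of_nonneg_left h4 (mul_pos ht hc₄).le
    linarith
  nlinarith

/-- **The lower critical isotherm under the Coulomb bound** ("δ ≥ 5 with amplitude at η = 0"): if
`c/‖x‖ ≤ ⟨σ₀σ_x⟩_{β_c}` on `ℤ³ ∖ 0`, then `c' h^{1/5} ≤ m(β_c(3), h)` for `0 < h ≤ h₀`. Linear response of the
critical block from below (`t Σ_L ≤ ⟨M_L e^{tM_L}⟩`), Gaussian domination (`⟨e^{tM_L}⟩ ≤ e^{t²Σ_L/2}`), GKS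
block-field domination (S3) and `Σ_L ≍ L⁵` (S4), at `t = β_c h`, `L = ⌊(C t²)^{-1/5}⌋`. -/
theorem stub_lowerCriticalIsotherm :
    (∃ c : ℝ, 0 < c ∧ ∀ x : Site 3, x ≠ 0 → c / ‖x‖ ≤ criticalTwoPoint 3 x) →
      ∃ c h₀ : ℝ, 0 < c ∧ 0 < h₀ ∧ ∀ h : ℝ, 0 < h → h ≤ h₀ →
        c * h ^ ((1:ℝ) / 5) ≤ magnetizationInField 3 (criticalBeta 3) h := by
  intro hC
  obtain ⟨c₄, C₄, hc₄, hV⟩ := stub_blockVariance hC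
  have hβ : 0 < criticalBeta 3 := criticalBeta_pos_holds (d := 3) (by norm_num)
  obtain ⟨C', hC'⟩ : ∃ C' : ℝ, C' = max C₄ 1 := ⟨_, rfl⟩
  have hC'1 : 1 ≤ C' := hC' ▸ le_max_right _ _
  have hC'0 : 0 < C' := one_pos.trans_le hC'1
  have hC₄C' : C₄ ≤ C' := hC' ▸ le_max_left _ _
  refine ⟨c₄ / 216 * C' ^ (-(2:ℝ) / 5) * criticalBeta 3 ^ ((1:ℝ) / 5), 1 / (criticalBeta 3 * Real.sqrt C'),
    by positivity, by positivity, fun h hh hhh₀ => ?_⟩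
  obtain ⟨t, htdef⟩ : ∃ t : ℝ, t = criticalBeta 3 * h := ⟨_, rfl⟩
  have ht0 : 0 < t := htdef ▸ mul_pos hβ hh
  -- `C' t² ≤ 1`
  have hCt : C' * t ^ 2 ≤ 1 := by
    have hsq : Real.sqrt C' ^ 2 = C' := Real.sq_sqrt hC'0.le
    have hsC : 0 < Real.sqrt C' := Real.sqrt_pos.2 hC'0
    have h1 : t * Real.sqrt C' ≤ 1 := by
      have := mul_le_mul_of_nonneg_left hhh₀ (mul_pos hβ hsC).le
      calc t * Real.sqrt C' = criticalBeta 3 * Real.sqrt C' * h := by rw [htdef]; ring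
        _ ≤ criticalBeta 3 * Real.sqrt C' * (1 / (criticalBeta 3 * Real.sqrt C')) := this
        _ = 1 := by field_simp
    have h2 : 0 ≤ t * Real.sqrt C' := by positivity
    calc C' * t ^ 2 = (t * Real.sqrt C') ^ 2 := by
          rw [show (t * Real.sqrt C') ^ 2 = t ^ 2 * Real.sqrt C' ^ 2 from mul_pow _ _ _, hsq]; ring
      _ ≤ 1 ^ 2 := pow_le_pow_left₀ h2 h1 2
      _ = 1 := one_pow 2
  have hCt0 : 0 < C' * t ^ 2 := by positivity
  -- the scale `x = (C' t²)^{-1/5} ≥ 1`, `L = ⌊x⌋ ≥ 1`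
  obtain ⟨x, hxdef⟩ : ∃ x : ℝ, x = (C' * t ^ 2) ^ (-(1:ℝ) / 5) := ⟨_, rfl⟩
  have hx1 : 1 ≤ x := by
    rw [hxdef]
    exact Real.one_le_rpow_of_pos_of_le_one_of_nonpos hCt0 hCt (by norm_num)
  have hx0 : 0 < x := one_pos.trans_le hx1
  obtain ⟨L, hLdef⟩ : ∃ L : ℕ, L = ⌊x⌋₊ := ⟨_, rfl⟩
  have hL1 : 1 ≤ L := hLdef ▸ (Nat.one_le_floor_iff _).2 hx1
  have hLx : (L : ℝ) ≤ x := hLdef ▸ Nat.floor_le hx0.le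
  have hxL : x ≤ 2 * L := by
    have h1 : x < (⌊x⌋₊ : ℝ) + 1 := Nat.lt_floor_add_one x
    rw [← hLdef] at h1
    have h2 : (1 : ℝ) ≤ L := by exact_mod_cast hL1
    linarith
  have hLr1 : (1 : ℝ) ≤ L := by exact_mod_cast hL1
  -- `x⁵ (C' t²) = 1`, so `t² Σ_L ≤ t² C₄ L⁵ ≤ C' t² x⁵ = 1`
  have hx5 : x ^ 5 * (C' * t ^ 2) = 1 := by
    rw [hxdef, ← Real.rpow_natCast, ← Real.rpow_mul hCt0.le]
    norm_num
    rw [Real.rpow_neg_one, inv_mul_cancel₀ hCt0.ne']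
  obtain ⟨hVlo, hVhi⟩ := hV L hL1
  obtain ⟨V, hVdef⟩ : ∃ V : ℝ, V = plusExpect 3 (criticalBeta 3) 0 (fun σ => (∑ y ∈ box 3 L, spinAt y σ) ^ 2) :=
    ⟨_, rfl⟩
  rw [← hVdef] at hVlo hVhi
  have htV : t ^ 2 * V ≤ 1 := by
    have hL5 : (L : ℝ) ^ 5 ≤ x ^ 5 := pow_le_pow_left₀ (by positivity) hLx 5
    calc t ^ 2 * V ≤ t ^ 2 * (C₄ * (L : ℝ) ^ 5) := mul_le_mul_of_nonneg_left hVhi (sq_nonneg t)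
      _ ≤ t ^ 2 * (C' * x ^ 5) := by
          refine mul_le_mul_of_nonneg_left ?_ (sq_nonneg t)
          exact mul_le_mul hC₄C' hL5 (by positivity) hC'0.le
      _ = x ^ 5 * (C' * t ^ 2) := by ring
      _ = 1 := hx5
  -- the pieces of the chain
  have hS3 := stub_blockFieldDomination L h hh.le
  have htilt := mul_blockVar_le_blockTilt L (t := criticalBeta 3 * h) (by positivity)
  rw [← hVdef] at htilt
  have hE : plusExpect 3 (criticalBeta 3) 0 (fun σ => Real.exp (criticalBeta 3 * h * ∑ y ∈ box 3 L, spinAt y σ)) ≤ 2 := by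
    refine (blockMgf_le_exp L (criticalBeta 3 * h)).trans ?_
    rw [← hVdef, ← htdef]
    have hexp2 : Real.exp (1 / 2) ≤ 2 := by
      have h := Real.exp_one_lt_d9
      have h2 : Real.exp (1 / 2) ^ 2 = Real.exp 1 := by rw [← Real.exp_nat_mul]; norm_num
      nlinarith [Real.exp_pos (1 / 2 : ℝ)]
    refine le_trans ?_ hexp2
    rw [Real.exp_le_exp]
    linarith
  have hm0 : 0 ≤ magnetizationInField 3 (criticalBeta 3) h := by
    rw [magnetizationInField_eq_plusCorr]; exact plusCorr_nonneg hβ.le hh.le {0}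
  have hmain := mag_lower_of_chain (mul_pos hβ hh) hc₄ hLr1 hxL hx0.le hVlo htilt hS3 hE hm0
  -- `t x² = C'^{-2/5} β_c^{1/5} h^{1/5}`
  have htx : t * x ^ 2 = C' ^ (-(2:ℝ) / 5) * (criticalBeta 3 ^ ((1:ℝ) / 5) * h ^ ((1:ℝ) / 5)) := by
    have e1 : x ^ 2 = C' ^ (-(2:ℝ) / 5) * t ^ (-(4:ℝ) / 5) := by
      rw [hxdef, ← Real.rpow_natCast, ← Real.rpow_mul hCt0.le, Real.mul_rpow hC'0.le (sq_nonneg t),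
        ← Real.rpow_natCast t 2, ← Real.rpow_mul ht0.le]
      norm_num
    have e2 : t * t ^ (-(4:ℝ) / 5) = t ^ ((1:ℝ) / 5) := by
      conv_lhs => rw [show t = t ^ (1:ℝ) from (Real.rpow_one t).symm]
      rw [← Real.rpow_mul ht0.le, ← Real.rpow_add ht0]
      norm_num
    have e3 : t ^ ((1:ℝ) / 5) = criticalBeta 3 ^ ((1:ℝ) / 5) * h ^ ((1:ℝ) / 5) := by
      rw [htdef, Real.mul_rpow hβ.le hh.le]
    calc t * x ^ 2 = C' ^ (-(2:ℝ) / 5) * (t * t ^ (-(4:ℝ) / 5)) := by rw [e1]; ring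
      _ = C' ^ (-(2:ℝ) / 5) * (criticalBeta 3 ^ ((1:ℝ) / 5) * h ^ ((1:ℝ) / 5)) := by rw [e2, e3]
  calc c₄ / 216 * C' ^ (-(2:ℝ) / 5) * criticalBeta 3 ^ ((1:ℝ) / 5) * h ^ ((1:ℝ) / 5)
      = c₄ / 216 * (t * x ^ 2) := by rw [htx]; ring
    _ = c₄ / 216 * (criticalBeta 3 * h * x ^ 2) := by rw [htdef]
    _ ≤ magnetizationInField 3 (criticalBeta 3) h := hmain

end Summit.CriticalPhenomena.Ising3DConformalLimit.PerfectScreeningCoulombImpliesNontrivial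

end
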